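import Summits.BirchSwinnertonDyer.Rank1Residual.O5.HeegnerLogTransportThreeOrdSelmerIndex
import Summits.BirchSwinnertonDyer.Rank1Residual.X11b.TwistTransportRam
import Summits.BirchSwinnertonDyer.Rank1Residual.X11b.CastellaErratumTwist
import Summits.BirchSwinnertonDyer.Rank1Residual.Supersingular.TwistStability
import Summits.BirchSwinnertonDyer.BirchSwinnertonDyer.Theorems.ToricSheddingUBPotentiallyGoodStubTwistAdmissible
import Literature.NumberTheory.EllipticCurves.BSDHeegnerPointsModularityOnlyProofs
import Literature.NumberTheory.EllipticCurves.AnalyticRankModularityProofs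
import Literature.NumberTheory.EllipticCurves.CuspFormLFunctionLevelConductorProofs
import Literature.NumberTheory.EllipticCurves.LeadingTermProofs
import Literature.NumberTheory.EllipticCurves.LFunctionSmulProofs
import Literature.NumberTheory.EllipticCurves.ModularDegreeQuadraticTwistProofs
import Literature.NumberTheory.QuadraticFields.FundamentalDiscriminant
import HarnessLib
import HarnessLib.Audit.Tags

/-!
# Heegner-log transport at `p = 3` (KL3), part 6: the row-C16 decoration of the companion pair is CLASS-LEVEL —
# surj(3) along the congruence, row C16 along the Heegner twist, the analytic ranks from Gross–Zagier — o5-r2 GEN 19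

HONEST FRAMING (cell `b2b-bsdres`, run/shared/lean/b2b/bsd-rank1-residual/, verbatim in every file): the
goal of the cell is to DELETE the COMBINATION-SHAPED residual classes of the Birch–Swinnerton-Dyer formula
for ALL analytic-rank `≤ 1` elliptic curves over `ℚ` — "full BSD formula for every rank `≤ 1` curve in
class `C`" assembled STRICTLY from published theorems — so that the rank-`≤ 1` remainder becomes exactly
the CONSTRUCTION-SHAPED classes, which are TYPED (missing-input `Prop`s), NOT attempted. This is not
"finishing BSD". Team O5 (tame potentially supersingular additive `p = 3`, (t′)), planner o5-r2 (the
non-Iwasawa side), GEN 19; RESEARCH ROUTE; THEOREMS ONLY (bookkeeping over explicit hypotheses): no new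
node, no `def`, no Literature fact, no `@[conjecture]`, no new object; NOTHING is booked and no mark of
`RESIDUAL-MAP.md` moves. O5 OPEN.

## What this file records (GEN 18 docket (c), ask A-KL3-TW; memo `HOME/b2b-bsdres-o5-r2/gen19/O5-GEN19.md`)

GEN 18 (part 5, `O5/HeegnerLogTransportThreeOrdSelmer{,Index}.lean`) proved KL3-C♭ (read at `ι₃ = embAt 𝔭`)
on good-ORDINARY companions modulo KL3-A/B/M/G, with the row-C16 decoration of the companion PAIR among
the binders of `o5_index_unit_of_goodOrd_companion_selmer`: `RowC16 G 3`, `RowC16 Gd 3`, `r_an(G) ≤ 1`,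
`r_an(Gd) ≤ 1`, `a₃(W) = 0`, `N_W ≠ 0`, `N_G ≠ 0`, the Heegner hypothesis for `N_W N_G`, and modularity in the
`hasEntireLFunction_rat` currency. This file DISCHARGES all of them from tree theorems and two named facts
that the END already leans on elsewhere (modularity `exists_isNewformOf`; Gross–Zagier `gross_zagier N′ G K`):

* §1 (PROVED) `surj_three_of_isCongruentModThree`: `ρ̄_{W,3}` onto ⇒ `ρ̄_{G,3}` onto for a mod-3 companion
  `G` — the tree's `Gal(ℚ̄/ℚ)`-equivariant `W[3] ≃+ G[3]` (`exists_addEquiv_geomTorsion_of_isCongruentModThree'`,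
  Darmon–Diamond–Taylor Prop. 2.6 (b)) conjugates the image (`twistAdmissible_surjective_toAddAut_of_signEquivariant`,
  sign branch unused). Hence `RowC16 G 3` from `GoodOrd G 3` alone on the companion side
  (`rowC16_three_of_goodOrd_of_isCongruentModThree`; `Irr` by `hasIrreducibleModPGaloisRep_of_isCongruentModThree`).
* §2 (PROVED) `rowC16_three_twist_of_heegner`: `RowC16 G 3 ⇒ RowC16 Gd 3` for every globally minimal model
  `Gd` of `G^{(d_K)}` with `3 ∤ d_K` and `K` Heegner for `N_G` — `GoodOrd` by `d_K = m` or `4m` (`m` squarefree,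
  `isFundamentalDiscriminant_discr`), `G^{(4m)} ≅ G^{(m)}` and the good-supersingular cell's twist lemmas
  (`Supersingular.hasGoodReductionAtPrime_of_smul_eq_quadraticTwist`, `…dvd_frobeniusTrace_iff…`, `3 ∤ 2m`);
  `Irr` by `X11b.irr_of_twist`; `Surj` by `twistAdmissible_hasSurjectiveModNGaloisRep_smul_quadraticTwist`;
  `Ram` by `X11b.ram_twist_of_heegner` (the (ram) witness `ℓ ∣ N_G` splits in `K`).
* §3 (PROVED) `analyticRank_pair_le_one_of_heegner_nonTorsion`: a Heegner point `P′ ∈ G(K)` of infinite order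
  gives `r_an(G) ≤ 1 ∧ r_an(Gd) ≤ 1` — bsd.S16 from `gross_zagier` and modularity
  (`analyticRankEK_eq_one_iff_heegner_nonTorsion_of_exists_isNewformOf`), `ord L(G/K) = r_an(G) + r_an(G^{(d_K)})`
  (`analyticRankEK_eq_add_of`), `N′ = N_G` (`IsNewformOf.level_eq_conductorNorm_of_exists_isNewformOf`),
  `analyticRank_smul`; and the Heegner hypothesis for `N_W N_G` from those for the levels `N, N′`
  (`satisfiesHeegnerHypothesis_conductor_mul_of_level`).
* §4 END `o5_index_unit_of_ordinary_companion` = GEN 18's `o5_index_unit_of_goodOrd_companion_selmer` with the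
  nine binders `hmod : hasEntireLFunction_rat`, `hWa3`, `hNW`, `hNG`, `hrG`, `hC16`, `hrGd`, `hC16d`, `hHWG`
  replaced by THREE: `hmod : exists_isNewformOf`, `hordG : GoodOrd G 3`, `hGZG : gross_zagier N′ G K`
  (`a₃(W) = 0` from `Addv W 3`: `LFunction_apply_eq_zero_of_not_good_of_not_mult`; `N ≠ 0` from
  `conductorNorm_pos_holds`). NET: on the companion side KL3-C♭ at `embAt 𝔭` now asks only that `G` be GOOD
  ORDINARY at `3` with a Heegner point of infinite order over the common Heegner field, the STEP-0 identity
  (Gross–Zagier in the census currency — the cell's standing explicit binder, as X11b's `GZParaphraseAt`), and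
  census-DECIDABLE units (Tamagawa, Manin, depletion); the W-side inputs are unchanged (surj(3), (t′) shape,
  `W(ℚ_ℓ)[3] = 0` at `3` and at the bad primes, `Ш(W/K)[3^∞] = 0`, one log-unit point). The non-print inputs
  remain exactly KL3-B, KL3-M (W-side Galois cohomology) and KL3-G (JSW17 Prop. 3.2.1, in print) as
  displayed hypotheses — D-0026: a printed theorem is PROVED or displayed, never `_holds` by citation.

References: H. Darmon, F. Diamond, R. Taylor, Fermat's Last Theorem (1995) Prop. 2.6 (b)
[DarmonDiamondTaylor1995]; J.-P. Serre, Invent. Math. 15 (1972) §4 [Serre1972]; J. H. Silverman, AEC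
VII.1, VII.5, X.5 Cor. 5.4, C.16 [SilvermanAEC2009]; A. W. Knapp, Elliptic Curves, Prop. 12.10 [Knapp1993];
B. H. Gross, D. Zagier, Invent. Math. 84 (1986) Thm. I.6.3, I.§7 [GrossZagier1986]; D. Jetchev, C. Skinner,
X. Wan, Camb. J. Math. 5 (2017) §7.3.1 [JetchevSkinnerWan2017]; F. Diamond, J. Shurman, GTM 228 Thm. 8.8.1,
8.8.3 [DiamondShurman2005]; X. Yan, X. Zhu, J. Algebra 693 (2026) Thm. 4.15 [YanZhu2024MainConjNonCM];
D. Kriz, C. Li, Forum Math. Sigma 7 (2019) Thm. 1.16 [KrizLi2019]; HOME/b2b-bsdres-o5-r2/gen19/O5-GEN19.md.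

## TYPER PLACEMENT NOTE (cc-typer-5 GEN 18 = O5 §3.5 / O6 §3.4 typer of record; by-name ask A-O5-G19-1 of o5-r2 GEN 19, HOME/INBOX.md l.13771:
'place by sha, the same way as A-O5-G18-1 … under 400, no split needed; suggested tree name `O5/HeegnerLogTransportThreeOrdTwist.lean`, KL3 part 6')

Source: `HOME/b2b-bsdres-o5-r2/gen19/lean/HeegnerLogTransportThreeOrdTwist.lean` sha16 `63c72a46f66a7fbe` (322 l.; `gen19/SHA16.txt`; o5-r2's joint scratch with part B's body
`gen19/lean/scratch/JointScratch_gen18B_gen19.lean` 391efccd7e89d14a rc 0 / 0 warnings 00:24Z, their direct check rc 75 at 00:29Z only because part B's olean was not yet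
built), re-hashed by the typer right before writing; THIS file = the source VERBATIM + this paragraph (imports, module text and every declaration block
byte-identical; script `class-closure/typer-5/gen18/g19_place.py`; the typer's own farm check against the tree with part B p345686 landed: rc 0 / 0 warnings, axioms of
the END `o5_index_unit_of_ordinary_companion` {propext, Classical.choice, Quot.sound}; DEDUP `lean search --decl` on the seven new names: no match).  CONTENT LABELS (source,
unchanged): THEOREMS ONLY — 0 `def`, 0 `@[conjecture]`, 0 Literature facts (net named-fact debt 0), no `sorry`; the non-print inputs stay the displayed hypotheses KL3-A /
KL3-B / KL3-M / KL3-G exactly as in parts 1–5 (`O5/HeegnerLogTransportThree{,Chain,Targets,Global}.lean` p340741 / p341262 / p341640 / p342632, `…OrdCompanion{,Index}.lean`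
p343587 / p344465, `…OrdSelmer{,Index}.lean` p345030 / p345686; `Literature/NumberTheory/EllipticCurves/HeegnerPointFiniteIndex.lean` p344022).  HONEST FRAMING (cell
`b2b-bsdres`): research route, lane CLASS-CLOSURE §3.5 O5; nothing asserted beyond the displayed binders, nothing booked, no mark of `RESIDUAL-MAP.md` moves; census =
EVIDENCE, never a Literature fact; O5 OPEN.
-/

set_option autoImplicit false

noncomputable section

open scoped Classical

open WeierstrassCurve Literature.NumberTheory.EllipticCurves
  Literature.NumberTheory.EllipticCurves.ModularForms
  Literature.NumberTheory.EllipticCurves.Rank1Residual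
  Literature.NumberTheory.EllipticCurves.Rank1Residual.Typed

namespace Summit.BirchSwinnertonDyer.Rank1Residual.O5.HeegnerLogTransport

open Summit.BirchSwinnertonDyer.Rank1Residual.X11b (padicLogOrd embAt)
open Summit.BirchSwinnertonDyer.BirchSwinnertonDyer.Theorems (twistAdmissible_exists_sq_eq_neg
  twistAdmissible_surjective_toAddAut_of_signEquivariant
  twistAdmissible_hasSurjectiveModNGaloisRep_smul_quadraticTwist)
open Literature.NumberTheory.EllipticCurves.Rank1Residual (Addv)
open IsDedekindDomain (HeightOneSpectrum)
open scoped NumberField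

/-! ## §1 The image hypotheses of row C16 along the mod-`3` congruence -/

/-- **`ρ̄_{G,3}` is onto when `ρ̄_{W,3}` is, for a mod-`3` companion `G` of `W`.** `ρ̄_{W,3}` onto makes
`W[3]` irreducible, so the congruence of traces off `3 N_W N_G` gives a `Gal(ℚ̄/ℚ)`-equivariant
`θ : W[3] ≃+ G[3]` (`exists_addEquiv_geomTorsion_of_isCongruentModThree'`, Brauer–Nesbitt–Chebotarev after
Darmon–Diamond–Taylor Prop. 2.6 (b)); conjugating by `θ` carries the image of `Gal(ℚ̄/ℚ) → Aut(W[3])` onto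
that of `Gal(ℚ̄/ℚ) → Aut(G[3])` (`twistAdmissible_surjective_toAddAut_of_signEquivariant` with the trivial
sign). [cite: DarmonDiamondTaylor1995, Prop. 2.6 (b) (PDF p. 53)] [cite: Serre1972, §4] -/
theorem surj_three_of_isCongruentModThree (W G : WeierstrassCurve ℚ) [W.IsElliptic]
    [W.IsGloballyMinimal] [G.IsElliptic] [G.IsGloballyMinimal] (hcong : IsCongruentModThree W G)
    (hρ : W.HasSurjectiveModNGaloisRep 3) : Surj G 3 := by
  have hirr : W.HasIrreducibleModPGaloisRep 3 :=
    hasIrreducibleModPGaloisRep_of_hasSurjectiveModNGaloisRep W 3 hρ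
  obtain ⟨θ, hθ⟩ := exists_addEquiv_geomTorsion_of_isCongruentModThree' W G hirr hcong
  obtain ⟨g, hg⟩ := twistAdmissible_exists_sq_eq_neg W 3
  refine twistAdmissible_surjective_toAddAut_of_signEquivariant θ.symm
    (fun σ ↦ Or.inl fun a ↦ θ.injective ?_) g hg hρ
  rw [AddEquiv.apply_symm_apply, hθ, AddEquiv.apply_symm_apply]

/-- **Row C16 for the companion from `GoodOrd G 3` alone.** For a mod-`3` companion `G` of `W` with
`ρ̄_{W,3}` onto: `G[3]` is irreducible (`hasIrreducibleModPGaloisRep_of_isCongruentModThree`) and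
`ρ̄_{G,3}` is onto (§1), so `RowC16 G 3 = (p = 3) ∧ GoodOrd ∧ Irr ∧ (Surj ∨ Ram)` reduces to
`GoodOrd G 3`. [cite: DarmonDiamondTaylor1995, Prop. 2.6 (b) (PDF p. 53)] -/
theorem rowC16_three_of_goodOrd_of_isCongruentModThree (W G : WeierstrassCurve ℚ) [W.IsElliptic]
    [W.IsGloballyMinimal] [G.IsElliptic] [G.IsGloballyMinimal] (hcong : IsCongruentModThree W G)
    (hρ : W.HasSurjectiveModNGaloisRep 3) (hord : GoodOrd G 3) : RowC16 G 3 :=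
  ⟨rfl, hord, hasIrreducibleModPGaloisRep_of_isCongruentModThree W G
    (hasIrreducibleModPGaloisRep_of_hasSurjectiveModNGaloisRep W 3 hρ) hcong,
    Or.inl (surj_three_of_isCongruentModThree W G hcong hρ)⟩

/-! ## §2 Row C16 passes to the Heegner twist -/

/-- **Good ordinary reduction at `3` passes to every globally minimal model `Gd` of `G^{(d_K)}` when
`3 ∤ d_K`.** `d_K` is a fundamental discriminant: `d_K = m` or `d_K = 4m` with `m` squarefree
(`isFundamentalDiscriminant_discr`), and `G^{(4m)} ≅ G^{(m)}` over `ℚ`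
(`exists_variableChange_quadraticTwist_mul_sq`), so `C′ • Gd = G^{(m)}` with `3 ∤ 2m`; then good
reduction and `3 ∤ a₃` pass to `Gd` (`a₃(Gd) = (m/3) a₃(G)`; the good-supersingular cell's
`Supersingular.hasGoodReductionAtPrime_of_smul_eq_quadraticTwist`,
`Supersingular.dvd_frobeniusTrace_iff_of_smul_eq_quadraticTwist`). [cite: Knapp1993, Prop. 12.10]
[cite: SilvermanAEC2009, VII.1 Remark 1.1 and VII.5 Prop. 5.1(a)] -/
theorem goodOrd_three_of_twist_model_discr (G Gd : WeierstrassCurve ℚ) [G.IsElliptic]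
    [G.IsGloballyMinimal] [Gd.IsElliptic] [Gd.IsGloballyMinimal] (K : Type) [Field K] [NumberField K]
    (hK : IsImaginaryQuadratic K) (h3d : ¬ ((3 : ℤ) ∣ NumberField.discr K))
    (hGd : ∃ C : VariableChange ℚ, C • G.quadraticTwist (NumberField.discr K : ℚ) = Gd)
    (hord : GoodOrd G 3) : GoodOrd Gd 3 := by
  obtain ⟨C, hC⟩ := hGd
  -- `d_K = m` or `4m` with `m` squarefree, `3 ∤ m`, and `G^{(d_K)} ≅ G^{(m)}` over `ℚ`
  obtain ⟨m, hsq, h3m, C₁, hC₁⟩ : ∃ m : ℤ, Squarefree m ∧ ¬ (3 : ℤ) ∣ m ∧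
      ∃ C₁ : VariableChange ℚ,
        C₁ • G.quadraticTwist (m : ℚ) = G.quadraticTwist (NumberField.discr K : ℚ) := by
    rcases Literature.NumberTheory.QuadraticFields.Quadratic.isFundamentalDiscriminant_discr
        (K := K) hK.1 with ⟨-, hsqD, -⟩ | ⟨h4, -, hsq4⟩
    · exact ⟨NumberField.discr K, hsqD, h3d, 1, one_smul _ _⟩
    · obtain ⟨m, hm⟩ := h4
      have hm' : NumberField.discr K / 4 = m := by
        rw [hm]; exact Int.mul_ediv_cancel_left m (by norm_num)
      refine ⟨m, hm' ▸ hsq4, fun h3m ↦ h3d (hm ▸ Dvd.dvd.mul_left h3m 4), ?_⟩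
      obtain ⟨C₂, hC₂⟩ := G.exists_variableChange_quadraticTwist_mul_sq (m : ℚ) 2 two_ne_zero
      refine ⟨C₂, ?_⟩
      rw [hC₂, hm]
      congr 1
      push_cast
      ring
  -- `(C₁⁻¹ C⁻¹) • Gd = G^{(m)}`
  have hC' : (C₁⁻¹ * C⁻¹) • Gd = G.quadraticTwist (m : ℚ) := by
    rw [mul_smul, ← hC, inv_smul_smul, ← hC₁, inv_smul_smul]
  have h32m : ¬ ((3 : ℕ) : ℤ) ∣ 2 * m := Supersingular.not_three_dvd_two_mul h3m
  exact ⟨Supersingular.hasGoodReductionAtPrime_of_smul_eq_quadraticTwist G Gd 3 hC' h32m hord.1,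
    fun h ↦ hord.2 ((Supersingular.dvd_frobeniusTrace_iff_of_smul_eq_quadraticTwist G Gd 3 hsq hC'
      h32m hord.1).mp h)⟩

/-- **Row C16 passes from `G` to every globally minimal model `Gd` of `G^{(d_K)}`** (`3 ∤ d_K`, `K`
imaginary quadratic and Heegner for `N_G`): `GoodOrd` by `goodOrd_three_of_twist_model_discr`; `Irr` by
`E^{(d)}[3] ≅ E[3] ⊗ χ_d` (`X11b.irr_of_twist`); `Surj` likewise
(`twistAdmissible_hasSurjectiveModNGaloisRep_smul_quadraticTwist`, the two images agree up to the central
`−1`); `Ram` because the (ram) witness `ℓ ∣ N_G` splits in `K`, so `d_K ∈ ℚ_ℓ^{×2}` and `Gd ≅ G` over `ℚ_ℓ`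
(`X11b.ram_twist_of_heegner`; Jetchev–Skinner–Wan 2017 §7.3.1). [cite: SilvermanAEC2009, X.5 Cor. 5.4]
[cite: JetchevSkinnerWan2017, §7.3.1 ((eq:tamK) and the preceding sentence)] -/
theorem rowC16_three_twist_of_heegner (G Gd : WeierstrassCurve ℚ) [G.IsElliptic]
    [G.IsGloballyMinimal] [Gd.IsElliptic] [Gd.IsGloballyMinimal] (K : Type) [Field K] [NumberField K]
    (hK : IsImaginaryQuadratic K) (hHG : SatisfiesHeegnerHypothesis (G.conductorNorm ℤ) K)
    (h3d : ¬ ((3 : ℤ) ∣ NumberField.discr K))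
    (hGd : ∃ C : VariableChange ℚ, C • G.quadraticTwist (NumberField.discr K : ℚ) = Gd)
    (h : RowC16 G 3) : RowC16 Gd 3 := by
  obtain ⟨-, hord, hirr, hsr⟩ := h
  obtain ⟨C, hC⟩ := hGd
  have hd0 : (NumberField.discr K : ℚ) ≠ 0 := by exact_mod_cast NumberField.discr_ne_zero K
  refine ⟨rfl, goodOrd_three_of_twist_model_discr G Gd K hK h3d ⟨C, hC⟩ hord,
    X11b.irr_of_twist G hd0 Gd hC hirr, ?_⟩
  rcases hsr with hsurj | hram
  · left
    rw [← hC]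
    exact twistAdmissible_hasSurjectiveModNGaloisRep_smul_quadraticTwist G hd0 C 3 hsurj
  · exact Or.inr (X11b.ram_twist_of_heegner G 3 K hK hHG hram C hC)

/-! ## §3 The analytic ranks of the companion pair and the Heegner hypothesis for `N_W N_G` -/

/-- **`r_an(G) ≤ 1` and `r_an(Gd) ≤ 1` from a Heegner point `P′ ∈ G(K)` of infinite order** (`Gd` any
`ℚ`-model of `G^{(d_K)}`): `ord_{s=1} L(G/K, s) = 1` (bsd.S16 from Gross–Zagier `gross_zagier N′ G K`
and modularity, `analyticRankEK_eq_one_iff_heegner_nonTorsion_of_exists_isNewformOf`, at `N′ = N_G` by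
`IsNewformOf.level_eq_conductorNorm_of_exists_isNewformOf`) and `ord L(G/K) = r_an(G) + r_an(G^{(d_K)})`
(`analyticRankEK_eq_add_of`, `analyticRank_smul`). [cite: GrossZagier1986, Thm. I.6.3 with V.§2 and I.§7] -/
theorem analyticRank_pair_le_one_of_heegner_nonTorsion (hmod : exists_isNewformOf)
    (G : WeierstrassCurve ℚ) [G.IsElliptic] [G.IsGloballyMinimal] {N' : ℕ} [NeZero N']
    (D' : ModularParametrizationData G N') (K : Type) [Field K] [NumberField K]
    (hK : IsImaginaryQuadratic K) (hH' : SatisfiesHeegnerHypothesis N' K)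
    (hGZ : gross_zagier N' G K) (Gd : WeierstrassCurve ℚ)
    (hGd : ∃ C : VariableChange ℚ, C • G.quadraticTwist (NumberField.discr K : ℚ) = Gd)
    {P' : (G.baseChange K).toAffine.Point} (hP' : IsHeegnerPoint N' G K P')
    (hP'inf : ¬ IsOfFinAddOrder P') : G.analyticRank ≤ 1 ∧ Gd.analyticRank ≤ 1 := by
  have hN' : G.conductorNorm ℤ = N' :=
    (IsNewformOf.level_eq_conductorNorm_of_exists_isNewformOf hmod D'.isNewformOf).symm
  have h1 : analyticRankEK G K = 1 :=
    (analyticRankEK_eq_one_iff_heegner_nonTorsion_of_exists_isNewformOf G N' K hGZ hmod hK hN' hH'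
      hP').mpr hP'inf
  rw [analyticRankEK_eq_add_of (hasEntireLFunction_rat_of_exists_isNewformOf hmod) G K] at h1
  have hd0 : (NumberField.discr K : ℚ) ≠ 0 := by exact_mod_cast NumberField.discr_ne_zero K
  haveI := G.isElliptic_quadraticTwist hd0
  obtain ⟨C, hC⟩ := hGd
  have hd : Gd.analyticRank = (G.quadraticTwist (NumberField.discr K : ℚ)).analyticRank := by
    rw [← hC]
    exact (G.quadraticTwist (NumberField.discr K : ℚ)).analyticRank_smul C
  constructor <;> omega

/-- **The Heegner hypothesis for `N_W N_G` from the Heegner hypotheses for the levels `N, N′` of modular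
parametrisations of `W, G`**: `N = N_W`, `N′ = N_G` (Carayol, from modularity:
`IsNewformOf.level_eq_conductorNorm_of_exists_isNewformOf`) and the hypothesis is multiplicative in the
level (`satisfiesHeegnerHypothesis_mul_iff`). [cite: DiamondShurman2005, Thm. 8.8.1] -/
theorem satisfiesHeegnerHypothesis_conductor_mul_of_level (hmod : exists_isNewformOf)
    (W G : WeierstrassCurve ℚ) [W.IsElliptic] [G.IsElliptic] {N N' : ℕ} [NeZero N] [NeZero N']
    (D : ModularParametrizationData W N) (D' : ModularParametrizationData G N')
    (K : Type) [Field K] [NumberField K]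
    (hH : SatisfiesHeegnerHypothesis N K) (hH' : SatisfiesHeegnerHypothesis N' K) :
    SatisfiesHeegnerHypothesis (W.conductorNorm ℤ * G.conductorNorm ℤ) K := by
  have hN : N = W.conductorNorm ℤ :=
    IsNewformOf.level_eq_conductorNorm_of_exists_isNewformOf hmod D.isNewformOf
  have hN' : N' = G.conductorNorm ℤ :=
    IsNewformOf.level_eq_conductorNorm_of_exists_isNewformOf hmod D'.isNewformOf
  exact satisfiesHeegnerHypothesis_mul_iff.mpr ⟨hN ▸ hH, hN' ▸ hH'⟩

/-! ## §4 END: KL3-C♭ on a good-ordinary companion — the companion-side decoration discharged -/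

/-- **KL3-C♭ (read at `ι₃ = embAt 𝔭`) on a good-ORDINARY companion, modulo KL3-A/B/M/G, with the row-C16
decoration of the companion pair DISCHARGED.** `W` (t′) at `3` (`Addv`, `v₃(j) ≥ 0`, `f₃ = 2`) with
`ρ̄_{W,3}` onto, `W(ℚ₃)[3] = 0` and `W(ℚ_ℓ)[3] = 0` at the primes `ℓ ≠ 3` of `N_W N_G`, Tamagawa and Manin
`3`-units, depletion units off `3`; `G` a globally minimal mod-`3` companion GOOD ORDINARY at `3`
(`GoodOrd G 3` — nothing else on the image side), `3 ∤ ∏ c_q(G)`, a globally minimal model `Gd` of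
`G^{(d_K)}`; a common imaginary quadratic `K` (`d_K < −4`, `3 ∤ d_K`) Heegner for the levels `N, N′` of the
two parametrisations, Kolyvagin for both curves and Gross–Zagier for `G` over `K` (named facts
`kolyvagin`, `gross_zagier` as displayed hypotheses), a degree-one prime `𝔭 ∣ 3` of `K`, Heegner points
`P, P′` of infinite order, `Ш(W/K)[3^∞] = 0`, ONE point `Q ∈ W(K)` of infinite order with
`ord₃ log_{ω_W} Q = 0`, and the STEP-0 identity of the pair (Gross–Zagier in the census currency). THEN
`3 ∤ [W(K) : ℤP]`. Proof: §1 gives `RowC16 G 3`, §2 gives `RowC16 Gd 3` (Heegner hypothesis for `N_G`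
from `N′ = N_G`), §3 gives both analytic ranks `≤ 1` and the Heegner hypothesis for `N_W N_G`,
`a₃(W) = 0` is `LFunction_apply_eq_zero_of_not_good_of_not_mult`, `N_W, N_G ≠ 0` is
`conductorNorm_pos_holds`, modularity in the `hasEntireLFunction_rat` currency is
`hasEntireLFunction_rat_of_exists_isNewformOf`; then GEN 18's `o5_index_unit_of_goodOrd_companion_selmer`
(row C16 = Yan–Zhu 2026 Thm. 4.15 `hYZ`, Wuthrich Lemma 20 `hW20`, GZK `hGZK`). Every published /
candidate input is an explicit binder (`hA` KL3-A, `hB` KL3-B, `hM` KL3-M, `hG` KL3-G).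
[cite: YanZhu2024MainConjNonCM, Thm. 4.15 (§4.6)] [cite: KrizLi2019, Thm. 1.16, Rem. 1.17]
[cite: JetchevSkinnerWan2017, Prop. 3.2.1 and (7.1.5)] [cite: GrossZagier1986, Thm. I.6.3 with V.§2] -/
theorem o5_index_unit_of_ordinary_companion
    (hA : KrizLiUnitBitTransportThree) (hB : O5BaseSelmerCountThree)
    (hM : ResidualSelmerMatchingThree) (hG : GoodBaseSelmerCountThree)
    (hYZ : YanZhu2026.thm415_padicValRat_bsd_rank_le_one)
    (hW20 : Wuthrich2014.lemma20_surjective_threeAdic_of_semistable)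
    (hmod : exists_isNewformOf) (hGZK : rank_eq_analyticRank_of_analyticRank_le_one)
    (W G : WeierstrassCurve ℚ) [W.IsElliptic] [W.IsGloballyMinimal] [G.IsElliptic] [G.IsGloballyMinimal]
    (hcong : ∀ ℓ : ℕ, ℓ.Prime → ¬ (ℓ ∣ 3 * W.conductorNorm ℤ * G.conductorNorm ℤ) →
      ((W.LFunction ℓ : ℤ) : ZMod 3) = ((G.LFunction ℓ : ℤ) : ZMod 3))
    (hρ : W.HasSurjectiveModNGaloisRep 3) (hadd : Addv W 3) (hj : 0 ≤ padicValRat 3 W.j)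
    (hf₂ : Additive.CondExpTwo W 3) (ht3 : NoLocalThreeTorsionAt W 3)
    (htℓ : ∀ (ℓ : ℕ) [Fact ℓ.Prime], ℓ ≠ 3 → (ℓ : ℤ) ∣ W.conductorNorm ℤ * G.conductorNorm ℤ →
      NoLocalThreeTorsionAt W ℓ)
    (hunitW : ∀ ℓ ∈ klSet W G, ℓ ≠ 3 → padicValInt 3 (nsCount W ℓ) = 0)
    (hunitG : ∀ ℓ ∈ klSet G W, ℓ ≠ 3 → padicValInt 3 (nsCount G ℓ) = 0)
    (htam : ¬ 3 ∣ W.tamagawaProduct) (htamG : ¬ 3 ∣ G.tamagawaProduct) (hordG : GoodOrd G 3)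
    (Gd : WeierstrassCurve ℚ) [Gd.IsElliptic] [Gd.IsGloballyMinimal]
    {N N' : ℕ} [NeZero N] [NeZero N'] (D : ModularParametrizationData W N)
    (D' : ModularParametrizationData G N')
    (K : Type) [Field K] [NumberField K] (hK : IsImaginaryQuadratic K)
    (hH : SatisfiesHeegnerHypothesis N K) (hH' : SatisfiesHeegnerHypothesis N' K)
    (hKoW : kolyvagin N W K) (hKoG : kolyvagin N' G K) (hGZG : gross_zagier N' G K)
    (hd : NumberField.discr K < -4) (h3d : ¬ ((3 : ℤ) ∣ NumberField.discr K))
    (hGd : ∃ C : VariableChange ℚ, C • G.quadraticTwist (NumberField.discr K : ℚ) = Gd)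
    (H : HeegnerDatum N (NumberField.discr K)) (H' : HeegnerDatum N' (NumberField.discr K))
    (ι : K →+* ℂ) (𝔭 : HeightOneSpectrum (𝓞 K)) (h𝔭 : ((3 : ℕ) : 𝓞 K) ∈ 𝔭.asIdeal)
    (he : 𝔭.asIdeal.ramificationIdx (𝓞 ℚ) = 1) (hf : 𝔭.asIdeal.inertiaDeg (𝓞 ℚ) = 1)
    (P : (W.baseChange K).toAffine.Point) (P' : (G.baseChange K).toAffine.Point)
    (hP : WeierstrassCurve.Affine.Point.map ι.toRatAlgHom P = heegnerPointComplex D H)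
    (hP' : WeierstrassCurve.Affine.Point.map ι.toRatAlgHom P' = heegnerPointComplex D' H')
    (hPinf : ¬ IsOfFinAddOrder P) (hP'inf : ¬ IsOfFinAddOrder P')
    (hshaW : Nat.card (AddCommGroup.primaryComponent (W.baseChange K).sha 3) = 1)
    (hQW : ∃ Q : (W.baseChange K).toAffine.Point, ¬ IsOfFinAddOrder Q ∧
      padicLogOrd W 3 (embAt K 3 𝔭 h𝔭 he hf) Q = 0)
    (hcD : padicValInt 3 D.maninConstant = 0) (hcD' : padicValInt 3 D'.maninConstant = 0)
    {q₀ q₁ : ℚ} (hq₀ : shaAn G = (q₀ : ℂ)) (hq₁ : shaAn Gd = (q₁ : ℂ))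
    (hstep0 : padicValRat 3 q₀ + padicValRat 3 q₁ + ((2 * padicValNat 3 G.tamagawaProduct : ℕ) : ℤ) +
        ((2 * padicValInt 3 D'.maninConstant : ℕ) : ℤ) =
      ((2 * padicValNat 3 (AddSubgroup.zmultiples P').index : ℕ) : ℤ)) :
    padicValNat 3 (AddSubgroup.zmultiples P).index = 0 := by
  -- the class-level discharges of GEN 19
  have hE : hasEntireLFunction_rat := hasEntireLFunction_rat_of_exists_isNewformOf hmod
  have hWa3 : W.LFunction 3 = 0 :=
    W.LFunction_apply_eq_zero_of_not_good_of_not_mult 3 hadd.1 hadd.2 (dvd_refl 3)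
  have hNW : W.conductorNorm ℤ ≠ 0 := (W.conductorNorm_pos_holds).ne'
  have hNG : G.conductorNorm ℤ ≠ 0 := (G.conductorNorm_pos_holds).ne'
  have hN' : N' = G.conductorNorm ℤ :=
    IsNewformOf.level_eq_conductorNorm_of_exists_isNewformOf hmod D'.isNewformOf
  have hHG : SatisfiesHeegnerHypothesis (G.conductorNorm ℤ) K := hN' ▸ hH'
  have hHWG : SatisfiesHeegnerHypothesis (W.conductorNorm ℤ * G.conductorNorm ℤ) K :=
    satisfiesHeegnerHypothesis_conductor_mul_of_level hmod W G D D' K hH hH'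
  -- row C16 for `G` (§1) and for `Gd` (§2)
  have hC16 : RowC16 G 3 := rowC16_three_of_goodOrd_of_isCongruentModThree W G hcong hρ hordG
  have hC16d : RowC16 Gd 3 := rowC16_three_twist_of_heegner G Gd K hK hHG h3d hGd hC16
  -- the analytic ranks of the pair (§3)
  obtain ⟨hrG, hrGd⟩ := analyticRank_pair_le_one_of_heegner_nonTorsion hmod G D' K hK hH' hGZG Gd hGd
    ⟨D', H', ι, hP'⟩ hP'inf
  exact o5_index_unit_of_goodOrd_companion_selmer hA hB hM hG hYZ hW20 hE hGZK W G hcong hρ hadd hj hf₂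
    hWa3 ht3 htℓ hNW hNG hunitW hunitG htam htamG hrG hC16 Gd hrGd hC16d D D' K hK hH hH' hHWG hKoW hKoG
    hd h3d hGd H H' ι 𝔭 h𝔭 he hf P P' hP hP' hPinf hP'inf hshaW hQW hcD hcD' hq₀ hq₁ hstep0

end Summit.BirchSwinnertonDyer.Rank1Residual.O5.HeegnerLogTransport

end
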